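import Summits.Ventures.YMGap.RobustBall.StringTensionAsymptotics
import HarnessLib

/-!
# Robust ball (Y2), area-law side — the static quark potential is LINEAR up to certified constants (SU(2), every coupling
of the window), and the floors uniform in the coupling

HONEST FRAMING: venture file of the cell `pub-ymgap` (QuantumFields programme), track ROBUST-BALL, seat rb-p2 (g4).  LATTICE statements
about infinite-volume limit states of the SU(2) torus Wilson states (tree coupling `β_W/2`); `V_μ(R) = staticPotential μ χ₂ R` exists for
every `R` at every `β > 0` (`WilsonStringTension.hasStaticPotential`).  Joining (i) rb-p2 g4's explicit linear LOWER bound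
(`StringTensionExplicit.wilson_staticPotential_ge_explicit`), (ii) Seiler's concavity bound `V(R) ≤ R·V(1)` and `V(1) ≤ −log W(1,1)` (lit-1's
`StaticPotentialConcavity`), (iii) the explicit plaquette floor `−log W_μ(1,1) ≤ log(32768 n/(49 β_W)) + 8 n β_W` (rb-p2 g3's `u₀` with
`V₀ ≥ 49/4096`, `StringTensionAsymptotics`):  for `d = n + 1 ≥ 2`, `0 < β_W ≤ 2/n`, every limit state and every `R ≥ 1`,
`log(2/(nβ_W))·R − 2·log(512/(nβ_W)) ≤ V_μ(R) ≤ (log(32768 n/(49β_W)) + 8nβ_W)·R` — linear confinement with a certified slope bracket;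
`d = 4`: slopes `log(2/(3β_W))` and `log(98304/(49β_W)) + 24β_W`.  Also the floors UNIFORM in the coupling («UpTo» form): on `0 < β_W ≤ β⋆ ≤ 2/3`,
`σ(μ) ≥ log(2/(3β⋆))`.  Constants are door / one-link artefacts; nothing continuum / spectral / Clay.

References: E. Seiler, Phys. Rev. D 18 (1978) 482; E. Seiler, LNP 159 (1982) §2; C. Bachas, Phys. Rev. D 33 (1986) 2723.
-/

noncomputable section

open MeasureTheory Filter Topology
open Literature.MathematicalPhysics.QuantumLattice
open Literature.MathematicalPhysics.QuantumFieldTheory hiding ZdEdge Site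

namespace Summit.Ventures.YMGap.RobustBall

namespace StringTensionExplicit

variable {n : ℕ}

/-- **Explicit plaquette floor in logarithmic form, SU(2), dimension `n + 1 ≥ 2`**: for every `β_W > 0` and every infinite-volume limit
state at tree coupling `β_W/2`, `−log W_μ(1,1) ≤ log(32768 n/(49 β_W)) + 8 n β_W` (rb-p2 g3's `rectExpectation_one_one_ge` with
`V₀ ≥ 49/4096`). [folklore] -/
theorem su2_neg_log_plaquette_le (hn : 1 ≤ n) {βW : ℝ} (hβ : 0 < βW) {μ : Measure (LGConfig (n + 1) (SUN 2))}
    (hμ : haveI : NeZero (n + 1) := ⟨by omega⟩; μ ∈ infiniteVolumeLimitPoints (fundamentalRep (Fin 2)) (βW / 2)) :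
    haveI : NeZero (n + 1) := ⟨by omega⟩
    (-Real.log (rectExpectation μ (fun g => normalisedCharacter 2 (fundamentalRep (Fin 2) g)) 0 1 1 1)) ≤
      Real.log (32768 * n / (49 * βW)) + 8 * n * βW := by
  haveI : NeZero (n + 1) := ⟨by omega⟩
  have hρ := TorusAreaLaw.isSpecialUnitaryModel_fundamentalRep 2
  obtain ⟨-, -, -, hu⟩ := WilsonStringTension.stringTension_le (d := n + 1) (fundamentalRep (Fin 2)) hρ le_rfl
    (by omega) (by positivity : 0 < βW / 2) hμ
  have hV := charVariance_su2_ge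
  have hnr : (0 : ℝ) < n := by exact_mod_cast (show 0 < n by omega)
  have hd : ((n + 1 : ℕ) : ℝ) - 1 = n := by push_cast; ring
  rw [hd] at hu
  set E : ℝ := βW / 2 * Real.exp (-(8 * (n : ℝ) * (2 : ℕ) * (βW / 2))) with hE
  have hE0 : 0 < E := by positivity
  have hden : (0 : ℝ) < 2 * (n : ℝ) * (2 : ℕ) := by positivity
  have hlow : E * (49 / 4096) / (2 * (n : ℝ) * (2 : ℕ)) ≤
      E * PlaquetteLowerBound.charVariance (fundamentalRep (Fin 2)) / (2 * (n : ℝ) * (2 : ℕ)) :=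
    div_le_div_of_nonneg_right (mul_le_mul_of_nonneg_left hV hE0.le) hden.le
  have hpos : 0 < E * (49 / 4096) / (2 * (n : ℝ) * (2 : ℕ)) := by positivity
  have hlog : -Real.log (E * PlaquetteLowerBound.charVariance (fundamentalRep (Fin 2)) / (2 * (n : ℝ) * (2 : ℕ))) ≤
      -Real.log (E * (49 / 4096) / (2 * (n : ℝ) * (2 : ℕ))) :=
    neg_le_neg (Real.log_le_log hpos hlow)
  have hval : -Real.log (E * (49 / 4096) / (2 * (n : ℝ) * (2 : ℕ))) = Real.log (32768 * n / (49 * βW)) + 8 * n * βW := by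
    have e1 : E * (49 / 4096) / (2 * (n : ℝ) * (2 : ℕ)) = (49 * βW / (32768 * n)) * Real.exp (-(8 * n * βW)) := by
      rw [hE]; push_cast; ring_nf
    rw [e1, Real.log_mul (by positivity) (Real.exp_pos _).ne', Real.log_exp]
    have e2 : Real.log (49 * βW / (32768 * n)) = -Real.log (32768 * n / (49 * βW)) := by
      rw [← Real.log_inv, inv_div]
    rw [e2]; ring
  linarith

/-- **Explicit linear UPPER bound of the static potential, SU(2), dimension `n + 1 ≥ 2`** (Seiler's `V(R) ≤ R·V(1) ≤ R·(−log W(1,1))`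
made numerical): `V_μ(R) ≤ (log(32768 n/(49 β_W)) + 8 n β_W)·R` for every `R` and every limit state at every `β_W > 0`. [folklore] -/
theorem su2_staticPotential_le_linear (hn : 1 ≤ n) {βW : ℝ} (hβ : 0 < βW) {μ : Measure (LGConfig (n + 1) (SUN 2))}
    (hμ : haveI : NeZero (n + 1) := ⟨by omega⟩; μ ∈ infiniteVolumeLimitPoints (fundamentalRep (Fin 2)) (βW / 2)) (R : ℕ) :
    haveI : NeZero (n + 1) := ⟨by omega⟩
    staticPotential μ (fun g => normalisedCharacter 2 (fundamentalRep (Fin 2) g)) R ≤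
      (Real.log (32768 * n / (49 * βW)) + 8 * n * βW) * R := by
  haveI : NeZero (n + 1) := ⟨by omega⟩
  have hρ := TorusAreaLaw.isSpecialUnitaryModel_fundamentalRep 2
  have hW := WilsonStringTension.rectExpectation_ne_zero (d := n + 1) (fundamentalRep (Fin 2)) hρ le_rfl (by omega)
    (by positivity : 0 < βW / 2) hμ
  have hc : Continuous (fundamentalRep (Fin 2) : SUN 2 → Matrix (Fin 2) (Fin 2) ℂ) := continuous_fundamentalRep (Fin 2)
  have h1 := StaticPotential.staticPotential_le_mul (fundamentalRep (Fin 2)) (by omega) hc (by positivity : (0 : ℝ) ≤ βW / 2)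
    hμ hW R
  have h2 := StaticPotential.staticPotential_le_neg_log (fundamentalRep (Fin 2)) (by omega) hc
    (by positivity : (0 : ℝ) ≤ βW / 2) hμ hW 1
  have h3 := su2_neg_log_plaquette_le hn hβ hμ
  have hR : (0 : ℝ) ≤ R := Nat.cast_nonneg R
  calc staticPotential μ (fun g => normalisedCharacter 2 (fundamentalRep (Fin 2) g)) R
      ≤ R * staticPotential μ (fun g => normalisedCharacter 2 (fundamentalRep (Fin 2) g)) 1 := h1
    _ ≤ R * (Real.log (32768 * n / (49 * βW)) + 8 * n * βW) := mul_le_mul_of_nonneg_left (h2.trans h3) hR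
    _ = _ := by ring

/-- ★★ **THE STATIC QUARK POTENTIAL IS LINEAR UP TO CERTIFIED CONSTANTS** (SU(2), dimension `n + 1 ≥ 2`, `0 < β_W ≤ 2/n`): for every
infinite-volume limit state and every `R ≥ 1`,
`log(2/(nβ_W))·R − 2·log(512/(nβ_W)) ≤ V_μ(R) ≤ (log(32768 n/(49β_W)) + 8nβ_W)·R`. [folklore] -/
theorem su2_staticPotential_two_sided (hn : 1 ≤ n) {βW : ℝ} (hβ : 0 < βW) (hβ1 : (n : ℝ) * βW ≤ 2)
    {μ : Measure (LGConfig (n + 1) (SUN 2))}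
    (hμ : haveI : NeZero (n + 1) := ⟨by omega⟩; μ ∈ infiniteVolumeLimitPoints (fundamentalRep (Fin 2)) (βW / 2))
    (R : ℕ) (hR : 1 ≤ R) :
    haveI : NeZero (n + 1) := ⟨by omega⟩
    Real.log (2 / ((n : ℝ) * βW)) * R - 2 * Real.log (512 / ((n : ℝ) * βW)) ≤
        staticPotential μ (fun g => normalisedCharacter 2 (fundamentalRep (Fin 2) g)) R ∧
      staticPotential μ (fun g => normalisedCharacter 2 (fundamentalRep (Fin 2) g)) R ≤
        (Real.log (32768 * n / (49 * βW)) + 8 * n * βW) * R := by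
  haveI : NeZero (n + 1) := ⟨by omega⟩
  refine ⟨?_, su2_staticPotential_le_linear hn hβ hμ R⟩
  have hnpos : (0 : ℝ) < n := by exact_mod_cast (show 0 < n by omega)
  have habs : |βW / 2 / ((2 : ℕ) : ℝ)| = βW / 4 := by rw [abs_of_nonneg (by positivity)]; push_cast; ring
  have hcW : 2 * (n : ℝ) * |βW / 2 / ((2 : ℕ) : ℝ)| * 1 = n * βW / 2 := by rw [habs]; ring
  have hmod := SlabAreaLawDimensions.su2_oneLinkKRModulus_of_le_one (R := (n : ℝ) * βW / 2) (by linarith)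
  have hθ0 : 0 < (n : ℝ) * βW / 2 := by positivity
  have hθ1 : (n : ℝ) * βW / 2 ≤ 1 := by linarith
  obtain ⟨-, h⟩ := wilson_staticPotential_ge_explicit (n := n) (N := 2) le_rfl hn (by positivity) zero_le_one hmod
    (by rw [habs]; linarith) (by rw [hcW]; exact hθ1) hθ0 hθ1 hμ R hR
  rw [hcW, max_self] at h
  have hlog : Real.log (2 / ((n : ℝ) * βW)) = -Real.log ((n : ℝ) * βW / 2) := by
    rw [← Real.log_inv]; congr 1; field_simp
  have hD : (32 * ((2 : ℕ) : ℝ) ^ 3 / ((n : ℝ) * βW / 2)) = 512 / ((n : ℝ) * βW) := by push_cast; field_simp; ring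
  have hlog2 : Real.log ((512 / ((n : ℝ) * βW)) ^ 2) = 2 * Real.log (512 / ((n : ℝ) * βW)) := by
    rw [Real.log_pow]; push_cast; ring
  rw [hD, hlog2] at h
  rw [hlog]
  exact h

/-- ★★ **`d = 4`: `log(2/(3β_W))·R − 2·log(512/(3β_W)) ≤ V_μ(R) ≤ (log(98304/(49β_W)) + 24β_W)·R`** for every infinite-volume limit
state at every `0 < β_W ≤ 2/3` and every `R ≥ 1`. [folklore] -/
theorem su2_staticPotential_two_sided_dim4 {βW : ℝ} (hβ : 0 < βW) (hβ1 : βW ≤ 2 / 3) {μ : Measure (LGConfig 4 (SUN 2))}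
    (hμ : μ ∈ infiniteVolumeLimitPoints (fundamentalRep (Fin 2)) (βW / 2)) (R : ℕ) (hR : 1 ≤ R) :
    Real.log (2 / (3 * βW)) * R - 2 * Real.log (512 / (3 * βW)) ≤
        staticPotential μ (fun g => normalisedCharacter 2 (fundamentalRep (Fin 2) g)) R ∧
      staticPotential μ (fun g => normalisedCharacter 2 (fundamentalRep (Fin 2) g)) R ≤
        (Real.log (98304 / (49 * βW)) + 24 * βW) * R := by
  have h := su2_staticPotential_two_sided (n := 3) (by norm_num) hβ (by push_cast; linarith) hμ R hR
  push_cast at h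
  have e : (32768 : ℝ) * 3 = 98304 := by norm_num
  have e2 : (8 : ℝ) * 3 * βW = 24 * βW := by ring
  rw [e, e2] at h
  exact h

/-! ### The floors uniform in the coupling («UpTo» form) -/

/-- **SU(2), `d = 4`, uniform floor on a coupling segment**: for `0 < β_W ≤ β⋆ ≤ 2/3`, every infinite-volume limit state at `β_W` has
`σ(μ) ≥ log(2/(3β⋆))` — ONE floor for the whole segment `(0, β⋆]` (the floor is antitone in the coupling). [folklore] -/
theorem su2_stringTension_ge_log_upTo_dim4 {βs βW : ℝ} (hβ : 0 < βW) (hle : βW ≤ βs) (hβs : βs ≤ 2 / 3)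
    {μ : Measure (LGConfig 4 (SUN 2))} (hμ : μ ∈ infiniteVolumeLimitPoints (fundamentalRep (Fin 2)) (βW / 2)) :
    Real.log (2 / (3 * βs)) ≤ stringTension μ (fun g => normalisedCharacter 2 (fundamentalRep (Fin 2) g)) := by
  have hβs0 : 0 < βs := lt_of_lt_of_le hβ hle
  obtain ⟨-, h⟩ := su2_stringTension_ge_log_dim4 hβ (hle.trans hβs) hμ
  refine le_trans (Real.log_le_log (by positivity) ?_) h
  exact div_le_div_of_nonneg_left (by norm_num) (by positivity) (by linarith)

end StringTensionExplicit

end Summit.Ventures.YMGap.RobustBall
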